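import Summits.QuantumFields.YangMills.Theorems.LuscherReductionTwistedTraceScalingBTCorePair
import Summits.QuantumFields.YangMills.Theorems.TwistedTraceScaling.Negative.ModelPerturbedNearRigidity
import HarnessLib

/-!
# R50 (crux `TwistedTraceScaling`, stmt-QuantumFields-20203; C4-CORE, lane A's (C1) central transfer `central_transfer_two_sided_chart` and its (C1a)
# smearing constant `η₀ = coreEta L β 0 δu T R Γ σ + …`): the INPUT WINDOW `δu` and the ACTION WINDOW `σ` of the smearing amplitude `χ₀` are first-order costs —
# `η₀ ≥ 192|E|·βT²·δu` and `η₀ ≥ 1728 N_P·βT²·√σ` — so on any scale with `βT² ≥ 1` the choice `δu = β^{-s/2}`, `σ = β^{-s}` (`s < 1/3`) violates the package's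
# OFF-DIAG budget `b² ≤ εθλ_b(L³β)/16` through `b ≥ η₀`

Standing disprover `ym-cdisprove-20203-1` (gen 41), sequel to R21 (`…Negative.ModelPerturbedNearRigidity.offDiag_budget_false_of_first_order`: a box-uniform first-order
`b ≥ κβ^{-p}`, `p < 1/6`, never meets `b² ≤ εθλ_b/16`).  Lane A g18 (`pub/ym-fleet/ym-luscher-20007-p1/HANDOFF-g18.md`, DESIGN POINTS 2–4) feeds the (C1a) smearing
`central_transfer_smeared_two_sided` with the indicator amplitude `χ₀ = 𝟙{‖q(u_k) − 1‖ ≤ δu ∧ L³S₁(u) ≤ σ}`, `δu = β^{-s/2}`, `σ = β^{-s}`, and the fibre/core scale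
`T = max(r_f, T_W)`, `T_W = ε + 3L·R₁′ = O(Lβ^{-1/2}ℓ²)` (so `βT² = O(L²ℓ⁴) ≥ 1`), and then claims (point 4) that the two-sided constants' gap `η_c` has RATE
`polylog·β^{-1/2} + O(β^{-2s})`, «fine for `b = o(λ_b^{1/2})` iff `s > 1/6`».  The smearing factor `e^{±η₀}`, `η₀ = coreEta L β 0 δu T R Γ σ + coreEps1 + coreEps2`
(`…BOCentralSmearing`, `…BOCentralGlueInner`, `central_transfer_two_sided_chart`), is part of `η_c`, and `coreEta` (`…BTCorePair`) contains the near-pair terms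
`β|E|·192·α·T²` (`α = δu`: the input slow point ranges over the `δu`-window around `u′ = 1`) and `β·N_P·1728·T²·√σ` (`stepActionErr`): with `βT² ≥ 1` these are
`≥ 192|E|·β^{-s/2}` and `≥ 1728N_P·β^{-s/2}` — first order in the WINDOW radii, exponent `s/2 < 1/6` — so R21 applies verbatim:
* `coreEta_ge_window`, `coreEta_ge_sqrtAction` — the two first-order floors of `coreEta L β 0 δu T R Γ σ` (all other terms dropped; `β, δu, T, σ ≥ 0`);
* `sqrt_powScale` (`√(powScale s β) = powScale (s/2) β`), `coreEta_ge_of_window_schedule`, `coreEta_ge_of_action_schedule` (`βT² ≥ 1` ⇒ `η₀ ≥ 192|E|·powScale(s/2)β`,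
  resp. `≥ 1728N_P·powScale(s/2)β`);
* ★★★ `smearing_offDiag_budget_false_of_window` / ★★★ `smearing_offDiag_budget_false_of_action`: for `s < 1/3`, ANY functions `T, R, Γ, σ` (resp. `δu`) of `β` with
  `T, σ, δu ≥ 0` and `βT(β)² ≥ 1` eventually, and every real `ε, θ`: `¬ ∃ β₀, ∀ β ≥ β₀, ∃ b ≥ coreEta L β 0 (powScale (s/2) β) (T β) (R β) (Γ β) (σ β), b² ≤ εθλ_b(L³β)/16`
  (resp. with `σ β = powScale s β`).
READING (no kill; a schedule mistake with a cheap repair): the windows of `χ₀` must be the MINIMAL ones compatible with the floor hypothesis `hχlo` of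
`central_transfer_two_sided_chart` — `δu := 5MK·powScale s β`, `σ := 12L³(5MK)⁴·powScale (4s) β` — then both floors are `O((MK)L⁵ℓ⁴β^{-s} + (MK)²L^{13/2}ℓ⁴β^{-2s})`,
inside `o(λ_b^{1/2})` iff `s > 1/6` (lane A's own `offDiag_budget_of_core`, up to the polylog `ℓ⁴`, absorbed by any `s′ ∈ (1/6, s)`); the remaining terms of `η₀` are
`O(L⁶ℓ⁶β^{-1/2})`.  With `δu = β^{-s/2}` or `σ = β^{-s}` as announced, (B-OD)'s `b = o(λ_b^{1/2})` FAILS for every `s < 1/3`.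
HONEST FRAMING: exponent bookkeeping about the hypotheses of bricks of a stub of a child of the CONDITIONAL reduction route R2b1; nothing landed is refuted
(`central_transfer_two_sided_chart` is not yet in the tree and is a true implication for every `δu, σ`); (C1) rates, (C4), (C5), (B-ST), C4-CORE OPEN; not infinite volume,
not a gap, not Clay.
-/

set_option autoImplicit false

noncomputable section

open Real
open Literature.MathematicalPhysics.QuantumFieldTheory
open Literature.MathematicalPhysics.QuantumLattice
open Summit.QuantumFields.YangMills.Theorems.FemtoTransferGap
open Summit.QuantumFields.YangMills.Theorems.FemtoTransferGap.TwoLattice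
open Summit.QuantumFields.YangMills.Theorems.FemtoTransferGap.TwoLattice.ConstTube (coreEta)
open Summit.QuantumFields.YangMills.Theorems.FemtoTransferGap.TwoLattice.Cov (stepActionErr stepActionErr_nonneg)

namespace Summit.QuantumFields.YangMills.Theorems.TwistedTraceScaling.Negative.R50

variable {L : ℕ} [NeZero L]

/-! ## §1 The two first-order floors of the central smearing exponent `coreEta L β 0 δu T R Γ σ` -/

/-- The INPUT-WINDOW floor: `192·|E|·β·δu·T² ≤ coreEta L β 0 δu T R Γ σ` (the near-pair term `β|E|·192αT²` with `α = δu`; every other term is `≥ 0`). [folklore] -/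
theorem coreEta_ge_window {β δu T R Γ σ : ℝ} (hβ : 0 ≤ β) (hδu : 0 ≤ δu) (hT : 0 ≤ T) (hσ : 0 ≤ σ) :
    192 * (Fintype.card (Edge 3 L) : ℝ) * β * δu * T ^ 2 ≤ coreEta L β 0 δu T R Γ σ := by
  have hs : 0 ≤ stepActionErr (L := L) T σ := stepActionErr_nonneg hT
  have key : coreEta L β 0 δu T R Γ σ - 192 * (Fintype.card (Edge 3 L) : ℝ) * β * δu * T ^ 2 =
      β * ((Fintype.card (Edge 3 L) : ℝ) * (558 * δu ^ 2 * T ^ 2)) +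
        β / 2 * (100 * σ * (Fintype.card (Plaquette 3 L × Fin 3) : ℝ) * R ^ 2 + 2 * stepActionErr (L := L) T σ +
          10080 * δu * (Fintype.card (Plaquette 3 L × Fin 3) : ℝ) * R ^ 2) := by
    unfold coreEta; ring
  have hA : 0 ≤ β * ((Fintype.card (Edge 3 L) : ℝ) * (558 * δu ^ 2 * T ^ 2)) := by positivity
  have h1 : 0 ≤ 100 * σ * (Fintype.card (Plaquette 3 L × Fin 3) : ℝ) * R ^ 2 := by positivity
  have h2 : 0 ≤ 10080 * δu * (Fintype.card (Plaquette 3 L × Fin 3) : ℝ) * R ^ 2 := by positivity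
  have hB : 0 ≤ β / 2 * (100 * σ * (Fintype.card (Plaquette 3 L × Fin 3) : ℝ) * R ^ 2 + 2 * stepActionErr (L := L) T σ +
      10080 * δu * (Fintype.card (Plaquette 3 L × Fin 3) : ℝ) * R ^ 2) := mul_nonneg (by positivity) (by linarith)
  linarith

/-- The ACTION-WINDOW floor: `1728·N_P·β·T²·√σ ≤ coreEta L β 0 δu T R Γ σ` (the `τ²√σ` term of `stepActionErr T σ` inside `coreEta`; every other term is `≥ 0`).
[folklore] -/
theorem coreEta_ge_sqrtAction {β δu T R Γ σ : ℝ} (hβ : 0 ≤ β) (hδu : 0 ≤ δu) (hT : 0 ≤ T) (hσ : 0 ≤ σ) :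
    1728 * (Fintype.card (Plaquette 3 L) : ℝ) * β * T ^ 2 * Real.sqrt σ ≤ coreEta L β 0 δu T R Γ σ := by
  have key : coreEta L β 0 δu T R Γ σ - 1728 * (Fintype.card (Plaquette 3 L) : ℝ) * β * T ^ 2 * Real.sqrt σ =
      β * ((Fintype.card (Edge 3 L) : ℝ) * (558 * δu ^ 2 * T ^ 2 + 192 * δu * T ^ 2)) +
        β / 2 * (100 * σ * (Fintype.card (Plaquette 3 L × Fin 3) : ℝ) * R ^ 2 + 10080 * δu * (Fintype.card (Plaquette 3 L × Fin 3) : ℝ) * R ^ 2) +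
          β * ((Fintype.card (Plaquette 3 L) : ℝ) * (29376 * T ^ 3 + 700569 * T ^ 4)) := by
    unfold coreEta stepActionErr; ring
  have hA : 0 ≤ β * ((Fintype.card (Edge 3 L) : ℝ) * (558 * δu ^ 2 * T ^ 2 + 192 * δu * T ^ 2)) := by positivity
  have hB : 0 ≤ β / 2 * (100 * σ * (Fintype.card (Plaquette 3 L × Fin 3) : ℝ) * R ^ 2 +
      10080 * δu * (Fintype.card (Plaquette 3 L × Fin 3) : ℝ) * R ^ 2) := by positivity
  have hC : 0 ≤ β * ((Fintype.card (Plaquette 3 L) : ℝ) * (29376 * T ^ 3 + 700569 * T ^ 4)) := by positivity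
  linarith

/-! ## §2 On a scale with `βT² ≥ 1`, the windows `δu = β^{-s/2}`, `σ = β^{-s}` are first-order costs `≥ κ·powScale (s/2) β` -/

/-- `√(powScale s β) = powScale (s/2) β`. [folklore] -/
theorem sqrt_powScale (s β : ℝ) : Real.sqrt (powScale s β) = powScale (s / 2) β := by
  have h : powScale (s / 2) β ^ 2 = powScale s β := by
    rw [R21.powScale_sq]; congr 1; ring
  rw [← h, Real.sqrt_sq (powScale_pos _ _).le]

/-- INPUT WINDOW `δu = powScale (s/2) β` on a scale with `βT² ≥ 1`: `η₀ ≥ 192·|E|·powScale (s/2) β`. [folklore] -/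
theorem coreEta_ge_of_window_schedule {β s T R Γ σ : ℝ} (hβ : 0 ≤ β) (hT : 0 ≤ T) (hσ : 0 ≤ σ) (hβT : 1 ≤ β * T ^ 2) :
    192 * (Fintype.card (Edge 3 L) : ℝ) * powScale (s / 2) β ≤ coreEta L β 0 (powScale (s / 2) β) T R Γ σ := by
  have hδu := (powScale_pos (s / 2) β).le
  have h := coreEta_ge_window (L := L) (R := R) (Γ := Γ) hβ hδu hT hσ
  have h' : 192 * (Fintype.card (Edge 3 L) : ℝ) * powScale (s / 2) β ≤
      192 * (Fintype.card (Edge 3 L) : ℝ) * β * powScale (s / 2) β * T ^ 2 := by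
    rw [show 192 * (Fintype.card (Edge 3 L) : ℝ) * β * powScale (s / 2) β * T ^ 2 =
        192 * (Fintype.card (Edge 3 L) : ℝ) * powScale (s / 2) β * (β * T ^ 2) by ring]
    exact le_mul_of_one_le_right (mul_nonneg (by positivity) (powScale_pos _ _).le) hβT
  exact h'.trans h

/-- ACTION WINDOW `σ = powScale s β` on a scale with `βT² ≥ 1`: `η₀ ≥ 1728·N_P·powScale (s/2) β`. [folklore] -/
theorem coreEta_ge_of_action_schedule {β s δu T R Γ : ℝ} (hβ : 0 ≤ β) (hδu : 0 ≤ δu) (hT : 0 ≤ T) (hβT : 1 ≤ β * T ^ 2) :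
    1728 * (Fintype.card (Plaquette 3 L) : ℝ) * powScale (s / 2) β ≤ coreEta L β 0 δu T R Γ (powScale s β) := by
  have h := coreEta_ge_sqrtAction (L := L) (R := R) (Γ := Γ) hβ hδu hT (powScale_pos s β).le
  rw [sqrt_powScale] at h
  have h' : 1728 * (Fintype.card (Plaquette 3 L) : ℝ) * powScale (s / 2) β ≤
      1728 * (Fintype.card (Plaquette 3 L) : ℝ) * β * T ^ 2 * powScale (s / 2) β := by
    rw [show 1728 * (Fintype.card (Plaquette 3 L) : ℝ) * β * T ^ 2 * powScale (s / 2) β =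
        1728 * (Fintype.card (Plaquette 3 L) : ℝ) * powScale (s / 2) β * (β * T ^ 2) by ring]
    exact le_mul_of_one_le_right (mul_nonneg (by positivity) (powScale_pos _ _).le) hβT
  exact h'.trans h

/-- `0 < 192·|E|` on the `L`-torus (`|E| = 3L³ ≥ 3`). [folklore] -/
theorem windowCoeff_pos : 0 < 192 * (Fintype.card (Edge 3 L) : ℝ) := by
  have h : (0 : ℝ) < Fintype.card (Edge 3 L) := by exact_mod_cast Fintype.card_pos
  exact mul_pos (by norm_num) h

/-- `0 < 1728·N_P` on the `L`-torus (`N_P = 3L³ ≥ 3`; a plaquette in the `(0,1)`-plane at any site witnesses `N_P > 0`). [folklore] -/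
theorem actionCoeff_pos : 0 < 1728 * (Fintype.card (Plaquette 3 L) : ℝ) := by
  have hne : Nonempty (Plaquette 3 L) := ⟨(Classical.arbitrary (Site 3 L), ⟨((0 : Fin 3), (1 : Fin 3)), by decide⟩)⟩
  have h : (0 : ℝ) < Fintype.card (Plaquette 3 L) := by exact_mod_cast Fintype.card_pos
  exact mul_pos (by norm_num) h

/-! ## §3 The OFF-DIAG budget fails through the smearing constant for `δu = β^{-s/2}` or `σ = β^{-s}`, `s < 1/3` -/

/-- ★★★ **INPUT WINDOW `δu = β^{-s/2}` KILLS THE OFF-DIAGONAL BUDGET** (`s < 1/3`; any real `ε, θ`; any `L ≥ 1`): for arbitrary scale functions `T, R, Γ, σ` of `β`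
with `T, σ ≥ 0` and `β·T(β)² ≥ 1` eventually (schedule B: `T = T_W = O(Lβ^{-1/2}ℓ²)`, `βT² = O(L²ℓ⁴) ≥ 1`), there is NO threshold beyond which some
`b ≥ η₀(β) = coreEta L β 0 (powScale (s/2) β) (T β) (R β) (Γ β) (σ β)` satisfies `b² ≤ ε·θ·λ_b(L³β)/16` — R21 `offDiag_budget_false_of_first_order` at `p = s/2 < 1/6`
with `κ = 192|E|`. [cite: Luscher1983, §3] -/
theorem smearing_offDiag_budget_false_of_window {s : ℝ} (hs : s < 1 / 3) {T R Γ σ : ℝ → ℝ} (hT0 : ∀ β, 0 ≤ T β) (hσ0 : ∀ β, 0 ≤ σ β)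
    (hβT : ∃ β₁ : ℝ, ∀ β : ℝ, β₁ ≤ β → 1 ≤ β * T β ^ 2) (ε θ : ℝ) :
    ¬ ∃ β0 : ℝ, ∀ β : ℝ, β0 ≤ β → ∃ b : ℝ, coreEta L β 0 (powScale (s / 2) β) (T β) (R β) (Γ β) (σ β) ≤ b ∧
        b ^ 2 ≤ ε * θ * bareLambda ((L : ℝ) ^ 3 * β) / 16 := by
  rintro ⟨β0, h⟩
  obtain ⟨β₁, hβ₁⟩ := hβT
  refine R21.offDiag_budget_false_of_first_order L (p := s / 2) (by linarith) (windowCoeff_pos (L := L)) ε θ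
    ⟨max (max β0 β₁) 0, fun β hβ => ?_⟩
  have hβ0' : β0 ≤ β := le_trans (le_trans (le_max_left _ _) (le_max_left _ _)) hβ
  have hβ₁' : β₁ ≤ β := le_trans (le_trans (le_max_right _ _) (le_max_left _ _)) hβ
  have hβnn : 0 ≤ β := le_trans (le_max_right _ _) hβ
  obtain ⟨b, hb, hb2⟩ := h β hβ0'
  exact ⟨b, (coreEta_ge_of_window_schedule (L := L) hβnn (hT0 β) (hσ0 β) (hβ₁ β hβ₁')).trans hb, hb2⟩

/-- ★★★ **ACTION WINDOW `σ = β^{-s}` KILLS THE OFF-DIAGONAL BUDGET** (`s < 1/3`; any real `ε, θ`; any `L ≥ 1`): for arbitrary scale functions `δu, T, R, Γ` of `β` with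
`δu, T ≥ 0` and `β·T(β)² ≥ 1` eventually, there is NO threshold beyond which some `b ≥ coreEta L β 0 (δu β) (T β) (R β) (Γ β) (powScale s β)` satisfies
`b² ≤ ε·θ·λ_b(L³β)/16` — R21 at `p = s/2 < 1/6` with `κ = 1728N_P`. [cite: Luscher1983, §3] -/
theorem smearing_offDiag_budget_false_of_action {s : ℝ} (hs : s < 1 / 3) {δu T R Γ : ℝ → ℝ} (hδu0 : ∀ β, 0 ≤ δu β) (hT0 : ∀ β, 0 ≤ T β)
    (hβT : ∃ β₁ : ℝ, ∀ β : ℝ, β₁ ≤ β → 1 ≤ β * T β ^ 2) (ε θ : ℝ) :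
    ¬ ∃ β0 : ℝ, ∀ β : ℝ, β0 ≤ β → ∃ b : ℝ, coreEta L β 0 (δu β) (T β) (R β) (Γ β) (powScale s β) ≤ b ∧
        b ^ 2 ≤ ε * θ * bareLambda ((L : ℝ) ^ 3 * β) / 16 := by
  rintro ⟨β0, h⟩
  obtain ⟨β₁, hβ₁⟩ := hβT
  refine R21.offDiag_budget_false_of_first_order L (p := s / 2) (by linarith) (actionCoeff_pos (L := L)) ε θ
    ⟨max (max β0 β₁) 0, fun β hβ => ?_⟩
  have hβ0' : β0 ≤ β := le_trans (le_trans (le_max_left _ _) (le_max_left _ _)) hβ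
  have hβ₁' : β₁ ≤ β := le_trans (le_trans (le_max_right _ _) (le_max_left _ _)) hβ
  have hβnn : 0 ≤ β := le_trans (le_max_right _ _) hβ
  obtain ⟨b, hb, hb2⟩ := h β hβ0'
  exact ⟨b, (coreEta_ge_of_action_schedule (L := L) hβnn (hδu0 β) (hT0 β) (hβ₁ β hβ₁')).trans hb, hb2⟩

/-! ## §4 Numbers on schedule B (informative examples) -/

/-- The scale of record has `βT_W² = (15Lℓ²)² ≥ 1` as soon as `15Lℓ² ≥ 1`; e.g. `T = 15L·ℓ²/√β`, `β > 0`, `1 ≤ 15Lℓ²` ⇒ `1 ≤ βT²`. [folklore] -/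
example {β Lr ℓ : ℝ} (hβ : 0 < β) (h : 1 ≤ 15 * Lr * ℓ ^ 2) : 1 ≤ β * (15 * Lr * ℓ ^ 2 / Real.sqrt β) ^ 2 := by
  have hs : Real.sqrt β ^ 2 = β := Real.sq_sqrt hβ.le
  have hs0 : 0 < Real.sqrt β := Real.sqrt_pos.2 hβ
  rw [div_pow, hs, mul_div_assoc', mul_div_cancel_left₀ _ hβ.ne']
  nlinarith

/-- Exponents: `s/2 < 1/6 ⇔ s < 1/3` (the whole C4-CORE window `s ∈ (1/6, 1/3)` is hit), while the repaired windows are first order in `powScale s β` /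
`powScale (2s) β` with `s > 1/6`, `2s > 1/6`. [folklore] -/
example {s : ℝ} (hs : s < 1 / 3) (hs' : 1 / 6 < s) : s / 2 < 1 / 6 ∧ 1 / 6 < s ∧ 1 / 6 < 2 * s := ⟨by linarith, hs', by linarith⟩

end Summit.QuantumFields.YangMills.Theorems.TwistedTraceScaling.Negative.R50

end
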